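import Summits.HubbardSuperconductivity.HubbardSuperconductivity.Theorems.BalabanIRBirGroundStateAverageLROBounds
import Literature.MathematicalPhysics.QuantumLattice.PairFieldYangCeiling

/-!
# Crux `BirGroundStateAverageLRO` (item `stmt-HubbardSuperconductivity-2079`): Yang's ceiling on the admissible constant

The crux (`Theses.BalabanIR.BirGroundStateAverageLRO`, route BalabanIR, target / rank 0) asks, on a
window of couplings `0 < U₁ < U < U₂`, eventually in even `L`, the ground-state-AVERAGE `d`-wave
pair LRO `c·L⁴·Re tr P ≤ Re tr (P Δ_d† Δ_d)` for the projection `P` onto the ground eigenspace of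
`hubbardTorus 2 L 1 U` in the sector `(2⌊(1-δ)L²/2⌋, S^z = 0)`.

The standing disprover's tightness theorem (`Cruxes/BirGroundStateAverageLRO/Disproof.lean` §2,
`const_le_of_witness`) bounds the admissible constant by the crude operator norm of the pair field:
`c ≤ C_d² = 32`. This file replaces the operator norm by **Yang's bound on the two-particle reduced
density matrix** (`Literature/…/PairFieldYangCeiling.lean`, from the tree's
`twoParticleRDM_rayleigh_le_holds`): `⟨ψ, Δ_d† Δ_d ψ⟩ ≤ 2N(2L² - N + 2) ‖ψ‖²` for EVERY `N`-particle
state, whence, with `N = 2⌊(1-δ)L²/2⌋ ≤ (1-δ)L²`: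

* `re_trace_sectorGroundProj_mul_pairField_dWave_le_yang` — for ANY Hamiltonian, any sector `(N, M)`
  with `N` even, `N ≤ 2L²`, `L ≥ 3`: `Re tr (P Δ_d† Δ_d) ≤ 2N(2L² - N + 2) · Re tr P`;
* `re_trace_groundProj_mul_pairField_le_yang` — in the crux's `let` vocabulary, at EVERY coupling `U`
  and every `δ ∈ [0, 1]`, `L ≥ 3`: `Re tr (P Δ_d† Δ_d) ≤ 2(1-δ)L²((1+δ)L² + 2) · Re tr P`;
* `avgBound_const_le_yang` — if the crux's inequality holds at ONE datum `(δ, U, c, L)` (`L ≥ 3`,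
  `δ ∈ [0,1]`), then `c ≤ 2(1-δ)(1+δ) + 4(1-δ)/L²`;
* `birGroundStateAverageLRO_witness_const_le_yang` — **every witness `(δ, U₁, U₂, c)` of the crux has
  `c ≤ 2(1 - δ²)`** (hence `c < 2`, `birGroundStateAverageLRO_witness_const_lt_two`), and the
  STRENGTHENING of the crux asking a constant above Yang's value is false
  (`not_birGroundStateAverageLRO_with_const_gt_yang`). The bound holds at every coupling, so it is a
  statement about the order functional, not about the Hubbard dynamics: Yang's value
  `N(M - N + 2)/M · ‖φ_d‖²` is what the `η`-paired extreme states reach for the uniform geminal; for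
  the `d_{x²-y²}` geminal it is an upper bound. Regime map for the crux: the admissible constants
  live in `(0, 2(1 - δ²)]`, and by `Negative/PairingCostUniform.lean` also below
  `10⁵·U₁·log²(4 + 32/√U₁)`.

Sources: C. N. Yang, Rev. Mod. Phys. 34 (1962) 694, §3–§4 (the bound `λ_max(ρ₂) ≤ N(M - N + 2)/M`
and `⟨Δ† Δ⟩ = φ† ρ₂ φ`); D. J. Scalapino, Phys. Rep. 250 (1995) 329, §2 eq. (2.4). Folklore
finite-dimensional statements; no named facts, no definitions. Nothing here asserts a Theses decl.
-/

noncomputable section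

namespace Summit.HubbardSuperconductivity.HubbardSuperconductivity.Theorems.BirGroundStateAverageLRO.Negative

open Matrix Finset Filter
open Literature.Probability.LatticeModels Literature.MathematicalPhysics.QuantumLattice
open Summit.HubbardSuperconductivity.HubbardSuperconductivity.Theorems
open scoped ComplexOrder

/-- **Yang's ceiling on the sector ground-state average, any Hamiltonian.** For `L ≥ 3`, a sector
`(N, M)` with `N` even and `N ≤ 2L²`, and ANY matrix `H` on the Fock space of the torus, the
projection `P` onto `E₀ = szSector N M ⊓ ker (H - e₀)` satisfies
`Re tr (P Δ_d† Δ_d) ≤ 2N(2L² - N + 2) · Re tr P` (average over `E₀` of Yang's per-state bound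
`re_expect_pairField_dWave_conjTranspose_mul_le_yang`, via `re_trace_projMatrix_mul_le`).
Yang, Rev. Mod. Phys. 34 (1962) 694, §3–§4. [folklore] -/
theorem re_trace_sectorGroundProj_mul_pairField_dWave_le_yang (L : ℕ) [NeZero L] (hL : 3 ≤ L)
    (H : Matrix (Finset (Orb (FermionTorus 2 L))) (Finset (Orb (FermionTorus 2 L))) ℂ)
    {N : ℕ} (hN : Even N) (hNL : N ≤ 2 * L ^ 2) (M : ℝ) :
    (projMatrix ((szSector N M ⊓ Module.End.eigenspace (Matrix.toLin' H)
        ((H.minEnergyOn (szSector N M) : ℝ) : ℂ)).map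
        (Fock.toEuclidean (ι := Orb (FermionTorus 2 L)) :
          Fock (Orb (FermionTorus 2 L)) →ₗ[ℂ]
            EuclideanSpace ℂ (Finset (Orb (FermionTorus 2 L))))) *
        ((pairField dWaveFormFactor L)ᴴ * pairField dWaveFormFactor L)).trace.re ≤
      2 * (N : ℝ) * (2 * (L : ℝ) ^ 2 - N + 2) *
        (projMatrix ((szSector N M ⊓ Module.End.eigenspace (Matrix.toLin' H)
          ((H.minEnergyOn (szSector N M) : ℝ) : ℂ)).map
          (Fock.toEuclidean (ι := Orb (FermionTorus 2 L)) :
            Fock (Orb (FermionTorus 2 L)) →ₗ[ℂ]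
              EuclideanSpace ℂ (Finset (Orb (FermionTorus 2 L)))))).trace.re := by
  rw [map_toEuclidean_eq]
  refine re_trace_projMatrix_mul_le _ _ _ fun v hv => ?_
  have hvN : IsNParticle N v := ((mem_szSector_iff N M v).1 (Submodule.mem_inf.1 hv).1).1
  exact re_expect_pairField_dWave_conjTranspose_mul_le_yang L hL hN hNL hvN

/-- `N = 2⌊(1-δ)L²/2⌋ ≤ (1-δ)L²` for `δ ≤ 1`. [folklore] -/
theorem cast_pairNumber_le {δ : ℝ} (hδ1 : δ ≤ 1) (L : ℕ) :
    ((2 * ⌊(1 - δ) * (L : ℝ) ^ 2 / 2⌋₊ : ℕ) : ℝ) ≤ (1 - δ) * (L : ℝ) ^ 2 := by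
  have hy : 0 ≤ (1 - δ) * (L : ℝ) ^ 2 / 2 := by
    have : (0 : ℝ) ≤ (L : ℝ) ^ 2 := by positivity
    have : 0 ≤ 1 - δ := by linarith
    positivity
  have hfl := Nat.floor_le hy
  push_cast
  linarith

/-- **Yang's ceiling in the crux's vocabulary, every coupling.** For `L ≥ 3`, `δ ∈ [0, 1]` and ANY
coupling `U`, the crux's data satisfy `Re tr (P Δ_d† Δ_d) ≤ 2(1-δ)L²((1+δ)L² + 2) · Re tr P`
(`N(2L² + 2 - N)` is increasing in `N ≤ L² + 1` and `N ≤ (1-δ)L²`). The inner `let`s are the crux's.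
Yang, Rev. Mod. Phys. 34 (1962) 694, §3–§4; Scalapino, Phys. Rep. 250 (1995) 329, §2. [folklore] -/
theorem re_trace_groundProj_mul_pairField_le_yang (L : ℕ) [NeZero L] (hL : 3 ≤ L) {δ : ℝ}
    (hδ0 : 0 ≤ δ) (hδ1 : δ ≤ 1) (U : ℝ) :
    let N : ℕ := 2 * ⌊(1 - δ) * (L : ℝ) ^ 2 / 2⌋₊
    let H := hubbardTorus 2 L 1 U
    let S := szSector (Λ := FermionTorus 2 L) N 0
    let E₀ := S ⊓ Module.End.eigenspace (Matrix.toLin' H) ((H.minEnergyOn S : ℝ) : ℂ)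
    let P := projMatrix (E₀.map (Fock.toEuclidean (ι := Orb (FermionTorus 2 L)) :
      Fock (Orb (FermionTorus 2 L)) →ₗ[ℂ] EuclideanSpace ℂ (Finset (Orb (FermionTorus 2 L)))))
    (P * ((pairField dWaveFormFactor L)ᴴ * pairField dWaveFormFactor L)).trace.re ≤
      2 * (1 - δ) * (L : ℝ) ^ 2 * ((1 + δ) * (L : ℝ) ^ 2 + 2) * P.trace.re := by
  intro N H S E₀ P
  have hNle : (N : ℝ) ≤ (1 - δ) * (L : ℝ) ^ 2 := cast_pairNumber_le hδ1 L
  have hL2 : (0 : ℝ) ≤ (L : ℝ) ^ 2 := by positivity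
  have hNL : N ≤ 2 * L ^ 2 := by
    have h : (N : ℝ) ≤ 2 * (L : ℝ) ^ 2 := by nlinarith
    exact_mod_cast h
  have hP := one_le_re_trace_groundProj_hubbardTorus L 1 U δ (by linarith)
  simp only at hP
  have h1 := re_trace_sectorGroundProj_mul_pairField_dWave_le_yang L hL H (even_two_mul _) hNL 0
  refine h1.trans (mul_le_mul_of_nonneg_right ?_ (by linarith))
  -- `2N(2L² - N + 2) ≤ 2(1-δ)L²((1+δ)L² + 2)`: monotonicity of `N(2L² + 2 - N)` on `N ≤ L² + 1`
  have hN0 : (0 : ℝ) ≤ N := Nat.cast_nonneg _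
  have hy : (1 - δ) * (L : ℝ) ^ 2 ≤ (L : ℝ) ^ 2 := by nlinarith
  nlinarith [mul_nonneg (sub_nonneg.2 hNle) (by nlinarith :
    (0 : ℝ) ≤ 2 * (L : ℝ) ^ 2 + 2 - N - (1 - δ) * (L : ℝ) ^ 2)]

/-- **Tightness by Yang's bound.** If the crux's ground-state-average bound
`c·L⁴·Re tr P ≤ Re tr (P Δ_d† Δ_d)` holds at ONE datum `(δ, U, c, L)` with `L ≥ 3` and `δ ∈ [0, 1]`
(any coupling `U`), then `c ≤ 2(1-δ)(1+δ) + 4(1-δ)/L²` (`Re tr P ≥ 1`). Compare the disprover's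
`const_le_of_avgBoundAt` (`c ≤ 32`). Yang, Rev. Mod. Phys. 34 (1962) 694, §3. [folklore] -/
theorem avgBound_const_le_yang (L : ℕ) [NeZero L] (hL : 3 ≤ L) {δ U c : ℝ} (hδ0 : 0 ≤ δ)
    (hδ1 : δ ≤ 1)
    (h : let N : ℕ := 2 * ⌊(1 - δ) * (L : ℝ) ^ 2 / 2⌋₊
      let H := hubbardTorus 2 L 1 U
      let S := szSector (Λ := FermionTorus 2 L) N 0
      let E₀ := S ⊓ Module.End.eigenspace (Matrix.toLin' H) ((H.minEnergyOn S : ℝ) : ℂ)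
      let P := projMatrix (E₀.map (Fock.toEuclidean (ι := Orb (FermionTorus 2 L)) :
        Fock (Orb (FermionTorus 2 L)) →ₗ[ℂ] EuclideanSpace ℂ (Finset (Orb (FermionTorus 2 L)))))
      c * (L : ℝ) ^ 4 * P.trace.re ≤
        (P * ((pairField dWaveFormFactor L)ᴴ * pairField dWaveFormFactor L)).trace.re) :
    c ≤ 2 * (1 - δ) * (1 + δ) + 4 * (1 - δ) / (L : ℝ) ^ 2 := by
  have hup := re_trace_groundProj_mul_pairField_le_yang L hL hδ0 hδ1 U
  have hP := one_le_re_trace_groundProj_hubbardTorus L 1 U δ (by linarith)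
  simp only at h hup hP
  set T := (projMatrix ((szSector (2 * ⌊(1 - δ) * (L : ℝ) ^ 2 / 2⌋₊) 0 ⊓
      Module.End.eigenspace (Matrix.toLin' (hubbardTorus 2 L 1 U))
        (((hubbardTorus 2 L 1 U).minEnergyOn (szSector (2 * ⌊(1 - δ) * (L : ℝ) ^ 2 / 2⌋₊) 0) : ℝ) :
          ℂ)).map (Fock.toEuclidean (ι := Orb (FermionTorus 2 L)) :
      Fock (Orb (FermionTorus 2 L)) →ₗ[ℂ] EuclideanSpace ℂ (Finset (Orb (FermionTorus 2 L)))))).trace.re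
    with hT
  have hL0 : (0 : ℝ) < (L : ℝ) := by exact_mod_cast Nat.pos_of_ne_zero (NeZero.ne L)
  have hL2 : (0 : ℝ) < (L : ℝ) ^ 2 := by positivity
  have hTpos : 0 < T := by linarith
  -- `c L⁴ T ≤ 2(1-δ)L²((1+δ)L² + 2) T`, divide by `L⁴ T > 0`
  have h1 : c * (L : ℝ) ^ 4 * T ≤ 2 * (1 - δ) * (L : ℝ) ^ 2 * ((1 + δ) * (L : ℝ) ^ 2 + 2) * T :=
    h.trans hup
  have h2 : c * (L : ℝ) ^ 4 ≤ 2 * (1 - δ) * (L : ℝ) ^ 2 * ((1 + δ) * (L : ℝ) ^ 2 + 2) :=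
    le_of_mul_le_mul_right h1 hTpos
  rw [show 2 * (1 - δ) * (1 + δ) + 4 * (1 - δ) / (L : ℝ) ^ 2 =
    (2 * (1 - δ) * (L : ℝ) ^ 2 * ((1 + δ) * (L : ℝ) ^ 2 + 2)) / (L : ℝ) ^ 4 by
      field_simp; ring]
  rw [le_div_iff₀ (by positivity)]
  exact h2

/-- **Every witness of the crux has `c ≤ 2(1 - δ²)`** (Yang's value for the `d_{x²-y²}` geminal at
hole doping `δ`): any `(δ, U₁, U₂, c)` with `δ ∈ (0,1/2)`, `U₁ < U₂` for which the crux's average bound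
holds eventually in even `L` at every coupling of `(U₁, U₂)` satisfies `c ≤ 2(1-δ)(1+δ)` (take one
coupling and even sides `L → ∞` in `avgBound_const_le_yang`). Compare the disprover's
`const_le_of_witness` (`c ≤ 32`). Yang, Rev. Mod. Phys. 34 (1962) 694, §3. [folklore] -/
theorem birGroundStateAverageLRO_witness_const_le_yang {δ U₁ U₂ c : ℝ}
    (hδ : δ ∈ Set.Ioo (0:ℝ) (1/2)) (hU : U₁ < U₂)
    (h : ∀ U ∈ Set.Ioo U₁ U₂, ∃ L₀ : ℕ, ∀ (L : ℕ) [NeZero L], L₀ ≤ L → Even L →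
      let N : ℕ := 2 * ⌊(1 - δ) * (L : ℝ) ^ 2 / 2⌋₊
      let H := hubbardTorus 2 L 1 U
      let S := szSector (Λ := FermionTorus 2 L) N 0
      let E₀ := S ⊓ Module.End.eigenspace (Matrix.toLin' H) ((H.minEnergyOn S : ℝ) : ℂ)
      let P := projMatrix (E₀.map (Fock.toEuclidean (ι := Orb (FermionTorus 2 L)) :
        Fock (Orb (FermionTorus 2 L)) →ₗ[ℂ] EuclideanSpace ℂ (Finset (Orb (FermionTorus 2 L)))))
      c * (L : ℝ) ^ 4 * P.trace.re ≤
        (P * ((pairField dWaveFormFactor L)ᴴ * pairField dWaveFormFactor L)).trace.re) :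
    c ≤ 2 * (1 - δ) * (1 + δ) := by
  by_contra hlt
  push Not at hlt
  set ε : ℝ := c - 2 * (1 - δ) * (1 + δ) with hε
  have hεpos : 0 < ε := by linarith
  obtain ⟨L₀, hL₀⟩ := h ((U₁ + U₂) / 2) ⟨by linarith, by linarith⟩
  set m : ℕ := max L₀ (⌈4 / ε⌉₊ + 2) with hm
  haveI : NeZero (2 * m) := ⟨by omega⟩
  have hbound := hL₀ (2 * m) (by omega) (even_two_mul m)
  have hc := avgBound_const_le_yang (2 * m) (by omega) hδ.1.le (by linarith [hδ.2]) hbound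
  -- `4(1-δ)/(2m)² ≤ 4/(2m) < ε`
  have hmR : (⌈4 / ε⌉₊ : ℝ) + 2 ≤ ((2 * m : ℕ) : ℝ) := by
    have : ⌈4 / ε⌉₊ + 2 ≤ 2 * m := by omega
    exact_mod_cast this
  have hceil : (4 / ε : ℝ) ≤ (⌈4 / ε⌉₊ : ℝ) := Nat.le_ceil _
  have hLpos : (0 : ℝ) < ((2 * m : ℕ) : ℝ) := by linarith [show (0:ℝ) ≤ (⌈4 / ε⌉₊ : ℝ) by positivity]
  have hge1 : (1 : ℝ) ≤ ((2 * m : ℕ) : ℝ) := by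
    have : 1 ≤ 2 * m := by omega
    exact_mod_cast this
  have hdiv : 4 / ε < ((2 * m : ℕ) : ℝ) := by linarith
  have h4 : 4 < ε * ((2 * m : ℕ) : ℝ) := by
    have := (div_lt_iff₀ hεpos).1 hdiv
    linarith
  have hfrac : 4 * (1 - δ) / ((2 * m : ℕ) : ℝ) ^ 2 < ε := by
    rw [div_lt_iff₀ (by positivity)]
    have hδ1 : 0 ≤ 1 - δ := by linarith [hδ.2]
    -- `4(1-δ) ≤ 4 ≤ 4·(2m) < ε (2m) ≤ ε (2m)²`
    nlinarith [hδ.1]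
  linarith

/-- **Hence every witness has `c < 2`.** [folklore] -/
theorem birGroundStateAverageLRO_witness_const_lt_two {δ U₁ U₂ c : ℝ}
    (hδ : δ ∈ Set.Ioo (0:ℝ) (1/2)) (hU : U₁ < U₂)
    (h : ∀ U ∈ Set.Ioo U₁ U₂, ∃ L₀ : ℕ, ∀ (L : ℕ) [NeZero L], L₀ ≤ L → Even L →
      let N : ℕ := 2 * ⌊(1 - δ) * (L : ℝ) ^ 2 / 2⌋₊
      let H := hubbardTorus 2 L 1 U
      let S := szSector (Λ := FermionTorus 2 L) N 0
      let E₀ := S ⊓ Module.End.eigenspace (Matrix.toLin' H) ((H.minEnergyOn S : ℝ) : ℂ)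
      let P := projMatrix (E₀.map (Fock.toEuclidean (ι := Orb (FermionTorus 2 L)) :
        Fock (Orb (FermionTorus 2 L)) →ₗ[ℂ] EuclideanSpace ℂ (Finset (Orb (FermionTorus 2 L)))))
      c * (L : ℝ) ^ 4 * P.trace.re ≤
        (P * ((pairField dWaveFormFactor L)ᴴ * pairField dWaveFormFactor L)).trace.re) :
    c < 2 := by
  have hc := birGroundStateAverageLRO_witness_const_le_yang hδ hU h
  nlinarith [hδ.1, hδ.2]

/-- **Refuted strengthening (constant above Yang's value).** There is NO witness of the crux with
`c > 2(1 - δ²)`: the crux `BirGroundStateAverageLRO` with the extra clause `2(1-δ)(1+δ) < c` is false.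
(The disprover's `not_crux_with_large_const` is the case `c > 32`.) Yang, Rev. Mod. Phys. 34 (1962)
694, §3. [folklore] -/
theorem not_birGroundStateAverageLRO_with_const_gt_yang :
    ¬ ∃ δ ∈ Set.Ioo (0:ℝ) (1/2), ∃ U₁ U₂ c : ℝ, 0 < U₁ ∧ U₁ < U₂ ∧ 2 * (1 - δ) * (1 + δ) < c ∧
        ∀ U ∈ Set.Ioo U₁ U₂, ∃ L₀ : ℕ, ∀ (L : ℕ) [NeZero L], L₀ ≤ L → Even L →
          let N : ℕ := 2 * ⌊(1 - δ) * (L : ℝ) ^ 2 / 2⌋₊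
          let H := hubbardTorus 2 L 1 U
          let S := szSector (Λ := FermionTorus 2 L) N 0
          let E₀ := S ⊓ Module.End.eigenspace (Matrix.toLin' H) ((H.minEnergyOn S : ℝ) : ℂ)
          let P := projMatrix (E₀.map (Fock.toEuclidean (ι := Orb (FermionTorus 2 L)) :
            Fock (Orb (FermionTorus 2 L)) →ₗ[ℂ]
              EuclideanSpace ℂ (Finset (Orb (FermionTorus 2 L)))))
          c * (L : ℝ) ^ 4 * P.trace.re ≤
            (P * ((pairField dWaveFormFactor L)ᴴ * pairField dWaveFormFactor L)).trace.re := by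
  rintro ⟨δ, hδ, U₁, U₂, c, -, hU, hc, h⟩
  have := birGroundStateAverageLRO_witness_const_le_yang hδ hU h
  linarith

/-- Registered one-line form (`--supports stmt-HubbardSuperconductivity-2079`, stub
`yangWitnessCeiling`): every witness `(δ, U₁, U₂, c)` of the crux has `c ≤ 2(1-δ)(1+δ)`.
Yang, Rev. Mod. Phys. 34 (1962) 694, §3. [folklore] -/
theorem yangWitnessCeiling : ∀ (δ U₁ U₂ c : ℝ), δ ∈ Set.Ioo (0:ℝ) (1/2) → U₁ < U₂ → (∀ U ∈ Set.Ioo U₁ U₂, ∃ L₀ : ℕ, ∀ (L : ℕ) [NeZero L], L₀ ≤ L → Even L → (let N : ℕ := 2 * ⌊(1 - δ) * (L : ℝ) ^ 2 / 2⌋₊; let H := Literature.MathematicalPhysics.QuantumLattice.hubbardTorus 2 L 1 U; let S := Literature.MathematicalPhysics.QuantumLattice.szSector (Λ := Literature.MathematicalPhysics.QuantumLattice.FermionTorus 2 L) N 0; let E₀ := S ⊓ Module.End.eigenspace (Matrix.toLin' H) ((H.minEnergyOn S : ℝ) : ℂ); let P := Literature.MathematicalPhysics.QuantumLattice.projMatrix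 (E₀.map (Literature.MathematicalPhysics.QuantumLattice.Fock.toEuclidean (ι := Literature.MathematicalPhysics.QuantumLattice.Orb (Literature.MathematicalPhysics.QuantumLattice.FermionTorus 2 L)) : Literature.MathematicalPhysics.QuantumLattice.Fock (Literature.MathematicalPhysics.QuantumLattice.Orb (Literature.MathematicalPhysics.QuantumLattice.FermionTorus 2 L)) →ₗ[ℂ] EuclideanSpace ℂ (Finset (Literature.MathematicalPhysics.QuantumLattice.Orb (Literature.MathematicalPhysics.QuantumLattice.FermionTorus 2 L))))); c * (L : ℝ) ^ 4 * P.trace.re ≤ (P * (Matrix.conjTranspose (Literature.MathematicalPhysics.QuantumLattice.pairField Literature.MathematicalPhysics.QuantumLattice.dWaveFormFactor L) * Literature.MathematicalPhysics.QuantumLattice.pairField Literature.MathematicalPhysics.QuantumLattice.dWaveFormFactor L)).trace.re)) → c ≤ 2 * (1 - δ) * (1 + δ) :=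
  fun _ _ _ _ hδ hU h => birGroundStateAverageLRO_witness_const_le_yang hδ hU h

end Summit.HubbardSuperconductivity.HubbardSuperconductivity.Theorems.BirGroundStateAverageLRO.Negative
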